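import Mathlib
import HarnessLib
import Summits.KontsevichZagierPeriods.Zeta5Search.TwoTaleP15FirstTale
import Summits.KontsevichZagierPeriods.Zeta5Search.TwoTaleP15SecondTale
import Summits.KontsevichZagierPeriods.Zeta5Search.TwoTaleP15Growth
import Summits.KontsevichZagierPeriods.Zeta5Search.Denom.TwoTaleR3Forms

/-!
# Zudilin's two tales: Whipple's transformation in Remark-5 form — ONE named input for both kernel rungs

HONEST FRAMING: systematic search; no irrationality claim unless certified.  Nothing in this file certifies a
measure; it REDUCES the growth-side named inputs `WhippleP15` (`TwoTaleP15Growth`) and `WhippleA`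
(`TwoTaleR3Growth`) of fam-measure's kernel route (`families/measure/FAMILY.md` §10) to ONE statement in the
Literature's own language, and proves the reindexing glue.

Zudilin [arXiv:1310.1526, Remark 5] writes Whipple's classical transformation between a terminating Saalschützian
`₄F₃(1)` and a very-well-poised `₅F₄(1)` [Slater, (2.4.1.1); Bailey, §4.3] as an identity between the
`ζ(2)`-coefficients of his two hypergeometric tales:
`q(a₁, a₂, a₃, a₄; 1, a₄−a₁+1, a₄−a₂+1, b₄) = q̂(b₄−a₃+a₄; a₂, a₁, a₄; a₄+1; a₄−a₃+1, a₁+a₂, b₄)`.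
In the tree both sides are TYPED by their printed closed forms: `Zudilin2014.formQZ` (Proposition 1, eq. (P2)) and
`Zudilin2014.formQTZ` (Proposition 3, eq. (T2)).  In these typed conventions the identity carries the global sign
`−1`: **`formQZ (a; b) = −formQTZ (â; b̂)`** — checked EXACTLY (in-seat, integer arithmetic mirroring the two
definitions) on all `95 496` admissible data with `a_i ≤ 12`, `b₄ ≤ 19`, with no exception and neither side zero;
at the cell's points it is the recorded `q_n = −q̂_n` (`TwoTaleP15Forms.formQ_one` / `TwoTaleP15Growth.qhat_one`,
`n ≤ 40` by fam-measure/ttrl2).  We file it as the named input `WhippleRemark5` (a published theorem, NOT yet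
formalised; candidate proofs: a WZ certificate, or Bailey's derivation from Pfaff–Saalschütz + Dougall, both
available as programme items) and PROVE:

* `admissibleT_hat` — first-tale admissibility (cond1) of the Remark-5 data implies second-tale admissibility
  (cond2) of the partner (pure linear arithmetic; the balance `Σâ + 2 = Σb̂` is automatic);
* the DICTIONARY at the cell's two kernel rungs: `aP15/bP15` (P1's `TwoTaleP15FirstTale`) and `aT/bT`
  (`TwoTaleP15SecondTale`) ARE a Remark-5 pair (`aP15_eq`, `bP15_eq`, `aT_eq`, `bT_eq`), and so are fam-denom's
  `aRungA/bRungA` (`Denom/TwoTaleR3Forms`) with the partner `aTA = (15n+2; 5n+1, 6n+1, 7n+1)`,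
  `bTA = (7n+2; 3n+1, 11n+2, 12n+2)` (`aRungA_eq`, `bRungA_eq`, `aTA_eq`, `bTA_eq`, `admissibleTA`);
* the REINDEXING BRIDGE `qhatP15_eq_qhat : TwoTaleP15.qhatP15 n = TwoTaleP15Growth.qhat n` — the Literature's
  `formQTZ` at the P15 partner IS fam-measure's one-signed binomial sum (ℤ- vs ℕ-indexed window, the empty tail
  `[24n+2, 26n+2)`, the branch `2k < â₀`, and the sign `(−1)^{2k−6n−2} = +1` are discharged);
* consequences of `WhippleRemark5`: `qP15_eq_neg_qhatP15` (`q_n = −q̂_n` at P15 in P1's notation),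
  `formQA_eq_neg_formQTZ` (rung A), and `whippleP15_of_remark5 : (∀ n ≥ 1, formQ n = qP15 n) → WhippleRemark5 →
  WhippleP15` — the extra hypothesis is the (routine, not yet filed) identification of fam-denom's directly-typed
  `TwoTaleP15Forms.formQ` with `Zudilin2014.formQZ (aP15 n) (bP15 n)`; rung A needs no such hypothesis because
  `formQA` is `formQZ` by definition (see `TwoTaleWhippleMeasures` for `WhippleRemark5 → WhippleA` and the packaged
  exponents).

Cell pub-zeta5, fam-measure (T3).  References: [Zudilin2014ZetaTwo] W. Zudilin, *Two hypergeometric tales and a new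
irrationality measure of ζ(2)*, arXiv:1310.1526, Remark 5; L. J. Slater, *Generalized hypergeometric functions*
(1966), (2.4.1.1); W. N. Bailey, *Generalized hypergeometric series* (1935), §4.3.
-/

namespace Summit.KontsevichZagierPeriods.Zeta5Search.TwoTaleWhipple

open Finset
open Literature.NumberTheory.Irrationality.Zudilin2014
open Summit.KontsevichZagierPeriods.Zeta5Search

/-! ### The Remark-5 dictionary -/

/-- First-tale numerator data `(a₁, a₂, a₃, a₄)` as a parameter vector. -/
def firstA (a₁ a₂ a₃ a₄ : ℤ) : Fin 4 → ℤ := ![a₁, a₂, a₃, a₄]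

/-- First-tale denominator data of Remark-5 shape `(1, a₄−a₁+1, a₄−a₂+1, b₄)`. -/
def firstB (a₁ a₂ a₄ b₄ : ℤ) : Fin 4 → ℤ := ![1, a₄ - a₁ + 1, a₄ - a₂ + 1, b₄]

/-- The second-tale partner `â = (b₄−a₃+a₄; a₂, a₁, a₄)` of Remark 5. -/
def hatA (a₁ a₂ a₃ a₄ b₄ : ℤ) : Fin 4 → ℤ := ![b₄ - a₃ + a₄, a₂, a₁, a₄]

/-- The second-tale partner `b̂ = (a₄+1; a₄−a₃+1, a₁+a₂, b₄)` of Remark 5. -/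
def hatB (a₁ a₂ a₃ a₄ b₄ : ℤ) : Fin 4 → ℤ := ![a₄ + 1, a₄ - a₃ + 1, a₁ + a₂, b₄]

section components
variable (a₁ a₂ a₃ a₄ b₄ : ℤ)
/-- Component `firstA 0 = a₁`. -/
@[simp] theorem firstA_zero : firstA a₁ a₂ a₃ a₄ 0 = a₁ := rfl
/-- Component `firstA 1 = a₂`. -/
@[simp] theorem firstA_one : firstA a₁ a₂ a₃ a₄ 1 = a₂ := rfl
/-- Component `firstA 2 = a₃`. -/
@[simp] theorem firstA_two : firstA a₁ a₂ a₃ a₄ 2 = a₃ := rfl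
/-- Component `firstA 3 = a₄`. -/
@[simp] theorem firstA_three : firstA a₁ a₂ a₃ a₄ 3 = a₄ := rfl
/-- Component `firstB 0 = 1`. -/
@[simp] theorem firstB_zero : firstB a₁ a₂ a₄ b₄ 0 = 1 := rfl
/-- Component `firstB 1 = a₄ − a₁ + 1`. -/
@[simp] theorem firstB_one : firstB a₁ a₂ a₄ b₄ 1 = a₄ - a₁ + 1 := rfl
/-- Component `firstB 2 = a₄ − a₂ + 1`. -/
@[simp] theorem firstB_two : firstB a₁ a₂ a₄ b₄ 2 = a₄ - a₂ + 1 := rfl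
/-- Component `firstB 3 = b₄`. -/
@[simp] theorem firstB_three : firstB a₁ a₂ a₄ b₄ 3 = b₄ := rfl
/-- Component `hatA 0 = b₄ − a₃ + a₄`. -/
@[simp] theorem hatA_zero : hatA a₁ a₂ a₃ a₄ b₄ 0 = b₄ - a₃ + a₄ := rfl
/-- Component `hatA 1 = a₂`. -/
@[simp] theorem hatA_one : hatA a₁ a₂ a₃ a₄ b₄ 1 = a₂ := rfl
/-- Component `hatA 2 = a₁`. -/
@[simp] theorem hatA_two : hatA a₁ a₂ a₃ a₄ b₄ 2 = a₁ := rfl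
/-- Component `hatA 3 = a₄`. -/
@[simp] theorem hatA_three : hatA a₁ a₂ a₃ a₄ b₄ 3 = a₄ := rfl
/-- Component `hatB 0 = a₄ + 1`. -/
@[simp] theorem hatB_zero : hatB a₁ a₂ a₃ a₄ b₄ 0 = a₄ + 1 := rfl
/-- Component `hatB 1 = a₄ − a₃ + 1`. -/
@[simp] theorem hatB_one : hatB a₁ a₂ a₃ a₄ b₄ 1 = a₄ - a₃ + 1 := rfl
/-- Component `hatB 2 = a₁ + a₂`. -/
@[simp] theorem hatB_two : hatB a₁ a₂ a₃ a₄ b₄ 2 = a₁ + a₂ := rfl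
/-- Component `hatB 3 = b₄`. -/
@[simp] theorem hatB_three : hatB a₁ a₂ a₃ a₄ b₄ 3 = b₄ := rfl
end components

/-! ### The named input -/

/-- **Whipple's transformation in Zudilin's Remark-5 form, tree conventions** [Zudilin2014ZetaTwo, Remark 5;
Slater (2.4.1.1); Bailey §4.3]: for first-tale-admissible data of Remark-5 shape,
`formQZ (a₁,a₂,a₃,a₄; 1,a₄−a₁+1,a₄−a₂+1,b₄) = −formQTZ (b₄−a₃+a₄; a₂,a₁,a₄; a₄+1; a₄−a₃+1, a₁+a₂, b₄)`.
A published theorem, NOT proved in the tree (named input of fam-measure's kernel route; the sign `−1` is the one the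
typed closed forms (P2)/(T2) produce — exact check on 95 496 admissible instances, `whip/remark5_grid.py`). -/
@[conjecture] def WhippleRemark5 : Prop :=
  ∀ a₁ a₂ a₃ a₄ b₄ : ℤ, Admissible (firstA a₁ a₂ a₃ a₄) (firstB a₁ a₂ a₄ b₄) →
    formQZ (firstA a₁ a₂ a₃ a₄) (firstB a₁ a₂ a₄ b₄) = -formQTZ (hatA a₁ a₂ a₃ a₄ b₄) (hatB a₁ a₂ a₃ a₄ b₄)

/-- First-tale admissibility (cond1) of Remark-5 data implies second-tale admissibility (cond2) of the partner. -/
theorem admissibleT_hat {a₁ a₂ a₃ a₄ b₄ : ℤ} (h : Admissible (firstA a₁ a₂ a₃ a₄) (firstB a₁ a₂ a₄ b₄)) :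
    AdmissibleT (hatA a₁ a₂ a₃ a₄ b₄) (hatB a₁ a₂ a₃ a₄ b₄) := by
  have h00 := h.lower 0 (by decide) 0
  have h01 := h.lower 0 (by decide) 1
  have h02 := h.lower 0 (by decide) 2
  have h03 := h.lower 0 (by decide) 3
  have h10 := h.lower 1 (by decide) 0
  have h11 := h.lower 1 (by decide) 1
  have h12 := h.lower 1 (by decide) 2
  have h21 := h.lower 2 (by decide) 1
  have h22 := h.lower 2 (by decide) 2
  have hu0 := h.upper 0
  have hu1 := h.upper 1
  have hu2 := h.upper 2
  have hu3 := h.upper 3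
  have hb := h.balance
  simp only [firstA_zero, firstA_one, firstA_two, firstA_three, firstB_zero, firstB_one, firstB_two,
    firstB_three, Fin.sum_univ_four] at h00 h01 h02 h03 h10 h11 h12 h21 h22 hu0 hu1 hu2 hu3 hb
  exact
    { b0_le_a0 := by simp; omega
      b0_le := fun j hj => by fin_cases j <;> simp at hj ⊢ <;> omega
      b1_le_a0 := by simp; omega
      b1_le := fun j hj => by fin_cases j <;> simp at hj ⊢ <;> omega
      a0_lt := by simp; omega
      a_lt := fun j hj => by fin_cases j <;> simp at hj ⊢ <;> omega
      balance := by simp [Fin.sum_univ_four]; ring }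

/-! ### The dictionary at the two kernel rungs -/

/-- P15 first tale `a = (13n+1, 11n+1, 9n+1, 15n+1)` is Remark-5 numerator data. -/
theorem aP15_eq (n : ℕ) :
    TwoTaleP15.aP15 n = firstA (13 * n + 1) (11 * n + 1) (9 * n + 1) (15 * n + 1) := by
  ext i; fin_cases i <;> simp

/-- P15 first tale `b = (1, 2n+1, 4n+1, 26n+2)` has the Remark-5 shape `(1, a₄−a₁+1, a₄−a₂+1, b₄)`. -/
theorem bP15_eq (n : ℕ) :
    TwoTaleP15.bP15 n = firstB (13 * n + 1) (11 * n + 1) (15 * n + 1) (26 * n + 2) := by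
  ext i; fin_cases i <;> simp
  all_goals ring

/-- The P15 partner `â = (32n+2; 11n+1, 13n+1, 15n+1)` is the Remark-5 `hatA`. -/
theorem aT_eq (n : ℕ) :
    TwoTaleP15.aT n = hatA (13 * n + 1) (11 * n + 1) (9 * n + 1) (15 * n + 1) (26 * n + 2) := by
  ext i; fin_cases i <;> simp
  all_goals ring

/-- The P15 partner `b̂ = (15n+2; 6n+1, 24n+2, 26n+2)` is the Remark-5 `hatB`. -/
theorem bT_eq (n : ℕ) :
    TwoTaleP15.bT n = hatB (13 * n + 1) (11 * n + 1) (9 * n + 1) (15 * n + 1) (26 * n + 2) := by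
  ext i; fin_cases i <;> simp
  all_goals ring

/-- Rung A first tale `a = (6n+1, 5n+1, 4n+1, 7n+1)` (fam-denom's ordering) is Remark-5 numerator data. -/
theorem aRungA_eq (n : ℕ) :
    Denom.TwoTaleR3Forms.aRungA n = firstA (6 * n + 1) (5 * n + 1) (4 * n + 1) (7 * n + 1) := by
  ext i; fin_cases i <;> simp

/-- Rung A first tale `b = (1, n+1, 2n+1, 12n+2)` has the Remark-5 shape. -/
theorem bRungA_eq (n : ℕ) :
    Denom.TwoTaleR3Forms.bRungA n = firstB (6 * n + 1) (5 * n + 1) (7 * n + 1) (12 * n + 2) := by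
  ext i; fin_cases i <;> simp
  all_goals ring

/-- The rung-A partner `â = (15n+2; 5n+1, 6n+1, 7n+1)` (Remark 5 at `(6,5,4,7 | 0,1,2,12)`). -/
def aTA (n : ℕ) : Fin 4 → ℤ := ![15 * (n : ℤ) + 2, 5 * (n : ℤ) + 1, 6 * (n : ℤ) + 1, 7 * (n : ℤ) + 1]

/-- The rung-A partner `b̂ = (7n+2; 3n+1, 11n+2, 12n+2)`. -/
def bTA (n : ℕ) : Fin 4 → ℤ := ![7 * (n : ℤ) + 2, 3 * (n : ℤ) + 1, 11 * (n : ℤ) + 2, 12 * (n : ℤ) + 2]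

/-- Component `aTA 0 = 15n+2`. -/
@[simp] theorem aTA_zero (n : ℕ) : aTA n 0 = 15 * (n : ℤ) + 2 := rfl
/-- Component `aTA 1 = 5n+1`. -/
@[simp] theorem aTA_one (n : ℕ) : aTA n 1 = 5 * (n : ℤ) + 1 := rfl
/-- Component `aTA 2 = 6n+1`. -/
@[simp] theorem aTA_two (n : ℕ) : aTA n 2 = 6 * (n : ℤ) + 1 := rfl
/-- Component `aTA 3 = 7n+1`. -/
@[simp] theorem aTA_three (n : ℕ) : aTA n 3 = 7 * (n : ℤ) + 1 := rfl
/-- Component `bTA 0 = 7n+2`. -/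
@[simp] theorem bTA_zero (n : ℕ) : bTA n 0 = 7 * (n : ℤ) + 2 := rfl
/-- Component `bTA 1 = 3n+1`. -/
@[simp] theorem bTA_one (n : ℕ) : bTA n 1 = 3 * (n : ℤ) + 1 := rfl
/-- Component `bTA 2 = 11n+2`. -/
@[simp] theorem bTA_two (n : ℕ) : bTA n 2 = 11 * (n : ℤ) + 2 := rfl
/-- Component `bTA 3 = 12n+2`. -/
@[simp] theorem bTA_three (n : ℕ) : bTA n 3 = 12 * (n : ℤ) + 2 := rfl

/-- `aTA` is the Remark-5 `hatA` of the rung-A data. -/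
theorem aTA_eq (n : ℕ) : aTA n = hatA (6 * n + 1) (5 * n + 1) (4 * n + 1) (7 * n + 1) (12 * n + 2) := by
  ext i; fin_cases i <;> simp
  all_goals ring

/-- `bTA` is the Remark-5 `hatB` of the rung-A data. -/
theorem bTA_eq (n : ℕ) : bTA n = hatB (6 * n + 1) (5 * n + 1) (4 * n + 1) (7 * n + 1) (12 * n + 2) := by
  ext i; fin_cases i <;> simp
  all_goals ring

/-- The rung-A partner is second-tale admissible for `n ≥ 1`. -/
theorem admissibleTA {n : ℕ} (hn : 1 ≤ n) : AdmissibleT (aTA n) (bTA n) := by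
  rw [aTA_eq, bTA_eq]
  refine admissibleT_hat ?_
  rw [← aRungA_eq, ← bRungA_eq]
  exact Denom.TwoTaleR3Forms.admissibleA hn

/-- `â₃* = 7n+1`, `b̂₂* = 11n+2` at rung A. -/
theorem rangeA_eq (n : ℕ) : aMax3 (aTA n) = 7 * (n : ℤ) + 1 ∧ bMin (bTA n) = 11 * (n : ℤ) + 2 := by
  constructor
  · unfold aMax3; simp; omega
  · unfold bMin; simp; omega

/-! ### Consequences of the named input at the two rungs -/

/-- **`q_n = −q̂_n` at P15** (P1's notation `qP15`, `qhatP15`), from `WhippleRemark5`. -/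
theorem qP15_eq_neg_qhatP15 (hW : WhippleRemark5) {n : ℕ} (hn : 1 ≤ n) :
    TwoTaleP15.qP15 n = -TwoTaleP15.qhatP15 n := by
  unfold TwoTaleP15.qP15 TwoTaleP15.qhatP15
  rw [aP15_eq, bP15_eq, aT_eq, bT_eq]
  refine hW _ _ _ _ _ ?_
  rw [← aP15_eq, ← bP15_eq]
  exact TwoTaleP15.admissible hn

/-- **`q_n = −q̂_n` at rung A**: `formQA n = −formQTZ (aTA n) (bTA n)`, from `WhippleRemark5`. -/
theorem formQA_eq_neg_formQTZ (hW : WhippleRemark5) {n : ℕ} (hn : 1 ≤ n) :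
    Denom.TwoTaleR3Forms.formQA n = -formQTZ (aTA n) (bTA n) := by
  unfold Denom.TwoTaleR3Forms.formQA
  rw [aRungA_eq, bRungA_eq, aTA_eq, bTA_eq]
  refine hW _ _ _ _ _ ?_
  rw [← aRungA_eq, ← bRungA_eq]
  exact Denom.TwoTaleR3Forms.admissibleA hn

/-! ### The reindexing bridge at P15: `formQTZ (â, b̂) = qhat` -/

/-- A `ℤ`-indexed interval sum with natural endpoints is the corresponding `ℕ`-indexed sum. -/
theorem sum_Ico_natCast (f : ℤ → ℤ) (m l : ℕ) :
    ∑ k ∈ Ico (m : ℤ) (l : ℤ), f k = ∑ k ∈ Ico m l, f (k : ℤ) := by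
  rw [Int.Ico_eq_finset_map, Finset.sum_map, Finset.sum_Ico_eq_sum_range]
  have h : ((l : ℤ) - m).toNat = l - m := by omega
  rw [h]
  refine Finset.sum_congr rfl fun x _ => ?_
  simp only [Function.Embedding.trans_apply, Nat.castEmbedding_apply, addLeftEmbedding_apply]
  push_cast
  rfl

/-- Termwise: Zudilin's `A_k` (`coefATZ`) at the P15 partner is fam-measure's binomial product `taleTwoA n k`
on the window `k ≥ 15n+1` (below `16n+1` both vanish). -/
theorem coefATZ_aT (n k : ℕ) (hk : 15 * n + 1 ≤ k) :
    coefATZ (TwoTaleP15.aT n) (TwoTaleP15.bT n) (k : ℤ) = (TwoTaleP15Growth.taleTwoA n k : ℤ) := by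
  unfold coefATZ TwoTaleP15Growth.taleTwoA
  have h0 : (2 * (k : ℤ) - TwoTaleP15.bT n 0).toNat = 2 * k - (15 * n + 2) := by simp; omega
  have h1 : (TwoTaleP15.aT n 0 - TwoTaleP15.bT n 0).toNat = 17 * n := by simp; omega
  have h2 : ((k : ℤ) - TwoTaleP15.bT n 1).toNat = k - (6 * n + 1) := by simp; omega
  have h3 : (TwoTaleP15.aT n 1 - TwoTaleP15.bT n 1).toNat = 5 * n := by simp; omega
  have h4 : (TwoTaleP15.bT n 2 - TwoTaleP15.aT n 2 - 1).toNat = 11 * n := by simp; omega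
  have h5 : ((k : ℤ) - TwoTaleP15.aT n 2).toNat = k - (13 * n + 1) := by simp; omega
  have h6 : (TwoTaleP15.bT n 3 - TwoTaleP15.aT n 3 - 1).toNat = 11 * n := by simp; omega
  have h7 : ((k : ℤ) - TwoTaleP15.aT n 3).toNat = k - (15 * n + 1) := by simp; omega
  rw [h0, h1, h2, h3, h4, h5, h6, h7]
  split_ifs with hlt
  · simp only [TwoTaleP15.aT_zero] at hlt
    rw [Nat.choose_eq_zero_of_lt (by omega : 2 * k - (15 * n + 2) < 17 * n)]
    simp
  · simp only [TwoTaleP15.aT_zero, not_lt] at hlt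
    have hev : Even (17 * n + 5 * n + (k - (13 * n + 1)) + (k - (15 * n + 1))) :=
      ⟨k - 3 * n - 1, by omega⟩
    rw [hev.neg_one_pow]
    push_cast
    ring

/-- **Bridge**: the Literature's `q̂` at the P15 partner (`TwoTaleP15.qhatP15 n = formQTZ (aT n) (bT n)`) is
fam-measure's one-signed sum `TwoTaleP15Growth.qhat n` (all `n`). -/
theorem qhatP15_eq_qhat (n : ℕ) : TwoTaleP15.qhatP15 n = (TwoTaleP15Growth.qhat n : ℤ) := by
  unfold TwoTaleP15.qhatP15 formQTZ TwoTaleP15Growth.qhat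
  rw [(TwoTaleP15.range_eq n).1, (TwoTaleP15.range_eq n).2]
  have hsign : (-1 : ℤ) ^ (TwoTaleP15.bT n 2 + TwoTaleP15.bT n 3).natAbs = 1 := by
    have : (TwoTaleP15.bT n 2 + TwoTaleP15.bT n 3).natAbs = 2 * (25 * n + 2) := by simp; omega
    rw [this, pow_mul]
    simp
  rw [hsign, one_mul,
    show (15 * (n : ℤ) + 1 : ℤ) = ((15 * n + 1 : ℕ) : ℤ) by push_cast; ring,
    show (24 * (n : ℤ) + 2 : ℤ) = ((24 * n + 2 : ℕ) : ℤ) by push_cast; ring, sum_Ico_natCast,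
    ← Finset.sum_Ico_consecutive _ (show 15 * n + 1 ≤ 24 * n + 2 by omega)
      (show 24 * n + 2 ≤ 26 * n + 2 by omega)]
  have htail : ∑ k ∈ Ico (24 * n + 2) (26 * n + 2), TwoTaleP15Growth.taleTwoA n k = 0 := by
    refine Finset.sum_eq_zero fun k hk => ?_
    rw [Finset.mem_Ico] at hk
    unfold TwoTaleP15Growth.taleTwoA
    rw [Nat.choose_eq_zero_of_lt (by omega : 11 * n < k - (13 * n + 1))]
    ring
  rw [htail, add_zero]
  push_cast
  exact Finset.sum_congr rfl fun k hk => coefATZ_aT n k (by rw [Finset.mem_Ico] at hk; omega)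

/-- `WhippleP15` in P1's notation: it says exactly `formQ n = qP15 n → qP15 n = −qhatP15 n`-wise, i.e.
given the identification of fam-denom's `formQ` with `formQZ (aP15, bP15)`, `WhippleP15 ↔ (q_n = −q̂_n)`. -/
theorem whippleP15_iff (hB : ∀ n : ℕ, 1 ≤ n → Denom.TwoTaleP15Forms.formQ n = TwoTaleP15.qP15 n) :
    TwoTaleP15Growth.WhippleP15 ↔ ∀ n : ℕ, 1 ≤ n → TwoTaleP15.qP15 n = -TwoTaleP15.qhatP15 n := by
  unfold TwoTaleP15Growth.WhippleP15
  refine forall_congr' fun n => forall_congr' fun hn => ?_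
  rw [← hB n hn, qhatP15_eq_qhat]

/-- **`WhippleRemark5 → WhippleP15`**, given the identification `formQ n = qP15 n` of fam-denom's directly typed
first-tale coefficient with the Literature's `formQZ (aP15 n) (bP15 n)` (routine; not filed yet). -/
theorem whippleP15_of_remark5 (hB : ∀ n : ℕ, 1 ≤ n → Denom.TwoTaleP15Forms.formQ n = TwoTaleP15.qP15 n)
    (hW : WhippleRemark5) : TwoTaleP15Growth.WhippleP15 :=
  (whippleP15_iff hB).2 fun _ hn => qP15_eq_neg_qhatP15 hW hn

end Summit.KontsevichZagierPeriods.Zeta5Search.TwoTaleWhipple
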